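import Mathlib.Topology.Connected.PathConnected
import Mathlib.Topology.Order.IntermediateValue
import Mathlib.Topology.UnitInterval
import HarnessLib

/-!
# Levels along an embedded arc through a critical point are monotone on each side

Topic `Literature/AlgebraicTopology/FundamentalGroup` (fact seat
`provefact-Literature.Topology.FourManifolds.lauden-f709dd520c`, Laudenbach–Poénaru's Lemma 2:
the loop through a `1`-handle runs along the left-hand disc `D_L(q)` of the index-`1` point `q`,
an embedded arc, and has to be cut at the two points of `D_L(q)` on a given level; for this one
needs that the Morse function is strictly monotone along each half of the arc).  Everything here
is **proved**; pure point-set topology, no named facts.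

**Lemma** (`lt_apply_of_mem_uIcc`, `strictMonoOn_comp`, `strictAntiOn_comp`).  Let
`C : [0, 1] → V` be an injective path in a Hausdorff space, `f : V → ℝ` any function and
`s_q ∈ [0, 1]` (think: `C` parametrises `D_L(q)`, `C s_q = q`).  Suppose that for every
parameter `s` there is a preconnected set `Γ ⊆ range C` containing `C s` and `C s_q` on which
`f > f (C s)` off `C s` (think: the closure of the forward trajectory of `C s`, along which `f`
increases strictly, converging to `q`).  Then `f ∘ C` is strictly increasing on `[0, s_q]` and
strictly decreasing on `[s_q, 1]`.  Proof: `C` is a closed embedding, so `C⁻¹(Γ)` is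
preconnected in `[0, 1]`, contains `s` and `s_q`, hence every parameter between them.

## References

* J. Milnor, *Lectures on the h-cobordism theorem* (1965), Def. 3.1 (1) and Def. 3.9 (PDF
  pp. 12, 16): `f` increases along the trajectories, `D_L` is the union of the trajectory
  segments ending at the critical point. [MilnorHCobordism1965]
-/

noncomputable section

open scoped unitInterval Topology
open Set Function

namespace Literature.AlgebraicTopology.FundamentalGroup

namespace ArcLevels

variable {V : Type*} [TopologicalSpace V] [T2Space V] {e₀ e₁ : V} (C : Path e₀ e₁) (hC : Injective C)
  (f : V → ℝ)

include hC in
/-- The preimage under an injective path of a preconnected subset of its range is preconnected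
(an injective path in a Hausdorff space is a closed embedding). [folklore] -/
theorem isPreconnected_preimage {Γ : Set V} (hΓ : IsPreconnected Γ) (hΓC : Γ ⊆ range C) :
    IsPreconnected (C ⁻¹' Γ) :=
  hΓ.preimage_of_isClosedMap hC C.continuous.isClosedMap hΓC

include hC in
/-- **Parameters between two parameters of a preconnected set of the arc belong to it.** [folklore] -/
theorem mem_preimage_of_mem_uIcc {Γ : Set V} (hΓ : IsPreconnected Γ) (hΓC : Γ ⊆ range C) {s s'' s' : I}
    (hs : C s ∈ Γ) (hs'' : C s'' ∈ Γ) (h : (s' : ℝ) ∈ uIcc (s : ℝ) s'') : C s' ∈ Γ := by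
  have hT : IsPreconnected (Subtype.val '' (C ⁻¹' Γ) : Set ℝ) :=
    (isPreconnected_preimage C hC hΓ hΓC).image _ continuous_subtype_val.continuousOn
  have h1 : (s : ℝ) ∈ Subtype.val '' (C ⁻¹' Γ) := ⟨s, hs, rfl⟩
  have h2 : (s'' : ℝ) ∈ Subtype.val '' (C ⁻¹' Γ) := ⟨s'', hs'', rfl⟩
  have h3 : (s' : ℝ) ∈ Subtype.val '' (C ⁻¹' Γ) := by
    rcases le_total (s : ℝ) s'' with hle | hle
    · rw [uIcc_of_le hle] at h; exact hT.Icc_subset h1 h2 h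
    · rw [uIcc_of_ge hle] at h; exact hT.Icc_subset h2 h1 h
  obtain ⟨t, ht, hts⟩ := h3
  have : t = s' := Subtype.ext hts
  rw [← this]; exact ht

include hC in
/-- **`f` is larger at every parameter between `s` and `s_q` than at `s`**, given a preconnected
`Γ ⊆ range C` through `C s` and `C s_q` on which `f > f (C s)` off `C s`.
[cite: MilnorHCobordism1965, Def. 3.1 (1) and Def. 3.9 (PDF pp. 12, 16)] -/
theorem lt_apply_of_mem_uIcc {s s_q : I} {Γ : Set V} (hΓ : IsPreconnected Γ) (hΓC : Γ ⊆ range C)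
    (hs : C s ∈ Γ) (hq : C s_q ∈ Γ) (hlt : ∀ z ∈ Γ, z ≠ C s → f (C s) < f z)
    {s' : I} (h : (s' : ℝ) ∈ uIcc (s : ℝ) s_q) (hne : s' ≠ s) : f (C s) < f (C s') :=
  hlt _ (mem_preimage_of_mem_uIcc C hC hΓ hΓC hs hq h) fun heq => hne (hC heq)

include hC in
/-- **Strict increase up to the critical parameter.**  If every parameter `s < s_q` admits such a
`Γ`, then `f ∘ C` is strictly increasing on `[0, s_q]`. [cite: MilnorHCobordism1965, Def. 3.1 (1) and Def. 3.9 (PDF pp. 12, 16)] -/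
theorem strictMonoOn_comp {s_q : I}
    (hΓ : ∀ s : I, s < s_q → ∃ Γ ⊆ range C, IsPreconnected Γ ∧ C s ∈ Γ ∧ C s_q ∈ Γ ∧
      ∀ z ∈ Γ, z ≠ C s → f (C s) < f z) :
    StrictMonoOn (f ∘ C) {s | s ≤ s_q} := by
  intro s hs s' hs' hss'
  obtain ⟨Γ, hΓC, hΓ', hsΓ, hqΓ, hlt⟩ := hΓ s (lt_of_lt_of_le hss' hs')
  refine lt_apply_of_mem_uIcc C hC f hΓ' hΓC hsΓ hqΓ hlt ?_ (ne_of_gt hss')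
  have h1 : (s : ℝ) ≤ s' := Subtype.coe_le_coe.2 hss'.le
  have h2 : (s' : ℝ) ≤ s_q := Subtype.coe_le_coe.2 hs'
  rw [uIcc_of_le (h1.trans h2)]; exact ⟨h1, h2⟩

include hC in
/-- **Strict decrease after the critical parameter.**  If every parameter `s > s_q` admits such a
`Γ`, then `f ∘ C` is strictly decreasing on `[s_q, 1]`. [cite: MilnorHCobordism1965, Def. 3.1 (1) and Def. 3.9 (PDF pp. 12, 16)] -/
theorem strictAntiOn_comp {s_q : I}
    (hΓ : ∀ s : I, s_q < s → ∃ Γ ⊆ range C, IsPreconnected Γ ∧ C s ∈ Γ ∧ C s_q ∈ Γ ∧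
      ∀ z ∈ Γ, z ≠ C s → f (C s) < f z) :
    StrictAntiOn (f ∘ C) {s | s_q ≤ s} := by
  intro s' hs' s hs hss'
  obtain ⟨Γ, hΓC, hΓ', hsΓ, hqΓ, hlt⟩ := hΓ s (lt_of_le_of_lt hs' hss')
  refine lt_apply_of_mem_uIcc C hC f hΓ' hΓC hsΓ hqΓ hlt ?_ (ne_of_lt hss')
  have h1 : (s' : ℝ) ≤ s := Subtype.coe_le_coe.2 hss'.le
  have h2 : (s_q : ℝ) ≤ s' := Subtype.coe_le_coe.2 hs'
  rw [uIcc_of_ge (h2.trans h1)]; exact ⟨h2, h1⟩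

/-! ### Consequences: the two parameters on a level, and the sides of a level -/

include hC in
/-- **On `[0, s_q]` the level `ℓ` is passed at most once, and below it lie exactly the earlier
parameters**: if `f (C s₁) = ℓ` with `s₁ ≤ s_q` then for `s ≤ s_q`, `f (C s) ≤ ℓ ↔ s ≤ s₁`.
[cite: MilnorHCobordism1965, Def. 3.9 (PDF p. 16)] -/
theorem apply_le_iff_le_of_le {s_q : I}
    (hΓ : ∀ s : I, s < s_q → ∃ Γ ⊆ range C, IsPreconnected Γ ∧ C s ∈ Γ ∧ C s_q ∈ Γ ∧
      ∀ z ∈ Γ, z ≠ C s → f (C s) < f z)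
    {s₁ : I} (hs₁ : s₁ ≤ s_q) {ℓ : ℝ} (hℓ : f (C s₁) = ℓ) {s : I} (hs : s ≤ s_q) :
    f (C s) ≤ ℓ ↔ s ≤ s₁ := by
  have hm := strictMonoOn_comp C hC f hΓ
  rw [← hℓ]
  exact hm.le_iff_le hs hs₁

include hC in
/-- The same on `[s_q, 1]`: if `f (C s₂) = ℓ` with `s_q ≤ s₂` then for `s_q ≤ s`,
`f (C s) ≤ ℓ ↔ s₂ ≤ s`. [cite: MilnorHCobordism1965, Def. 3.9 (PDF p. 16)] -/
theorem apply_le_iff_le_of_ge {s_q : I}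
    (hΓ : ∀ s : I, s_q < s → ∃ Γ ⊆ range C, IsPreconnected Γ ∧ C s ∈ Γ ∧ C s_q ∈ Γ ∧
      ∀ z ∈ Γ, z ≠ C s → f (C s) < f z)
    {s₂ : I} (hs₂ : s_q ≤ s₂) {ℓ : ℝ} (hℓ : f (C s₂) = ℓ) {s : I} (hs : s_q ≤ s) :
    f (C s) ≤ ℓ ↔ s₂ ≤ s := by
  have hm := strictAntiOn_comp C hC f hΓ
  rw [← hℓ]
  constructor
  · intro h
    by_contra hlt
    exact absurd h (not_le.2 (hm hs hs₂ (lt_of_not_ge hlt)))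
  · intro h
    rcases h.eq_or_lt with heq | hlt'
    · rw [heq]
    · exact (hm hs₂ hs hlt').le

end ArcLevels

end Literature.AlgebraicTopology.FundamentalGroup
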